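import Mathlib
import HarnessLib
import Summits.HubbardSuperconductivity.HubbardSuperconductivity.Theorems.KLProgrammeKLRegimeEngineTowerLevFloorUnitsDefs

/-!
# Route `KLProgramme` — crux K3 ENGINE (stmt-HubbardSuperconductivity-20437 `KLRegimeEngineV17F2`), stub (b) v2, THE LEVELS PACKAGE (ℓ), read-out (I6)-LEV in FLOOR units:
# THE LEVELLED LAW'S UNIT TIMES `A·λ^{p−1}·Q^p` IS `KernelNormsLevels`' RIGHT-HAND SIDE — the units-conversion row of the read-out, floor-keyed
# (cell gate-hubbard-kl, seat hubbard-kl-k3c3-p2 g14, (I5)/(I6) by the substitute precedent; located-risk #10 cure (ε), units `klLevUnitF` of p668906)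

Under the floor units `klLevUnitF β M t p J = ε_x^{2p−1}·8^{Jp}/(2^{5J}·2^{klLevGain t·J})`, `klLevGain t = levelGainExp (t+1)` (…TowerLevFloorUnitsDefs), a levelled law
`BornLev(2p, F = t+1)/klLevUnitF … t p J ≤ A·λ^{p−1}·Q^p` at the coupling `λ = B·ε_J` (`ε_J = epsCoupling P U J`) reads, multiplied out, EXACTLY in the shape of the
registered `KernelNormsLevels` right-hand side `CE^p·ε_J^{p−1}·2^{(3p−5)J}·(2^J)^{−levelGainExp F}` (…KernelNormsLevelsDefs l.132), with the threshold
**`CE ≥ (Q·ε_x²)·B·max 1 (A/ε_x)`** (`Qε_x²` and `A/ε_x` are the ε_x-free combinations of k3c2-p3's homogeneity table, KL STATUS l.9397):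

* §1 `eight_pow_div_eq_two_zpow` — `8^{Jp}/(2^{5J}·2^{eJ}) = 2^{(3p−5)J}·((2^J)⁻¹)^e` (ℤ-exponent as the predicate carries it); `klLevUnitF_eq_levels_shape`;
* §2 `law_amplitude_le_pow` — `A·B^{p−1}·Q^p·ε_x^{2p−1} ≤ CE^p` for `p ≥ 1`, `B ≥ 1` under the threshold;
* §3 **`law_mul_klLevUnitF_le_levelsRHS`** — `A·(B·ε_J)^{p−1}·Q^p·klLevUnitF β M t p J ≤ CE^p·ε_J^{p−1}·2^{(3p−5)J}·((2^J)⁻¹)^{levelGainExp (t+1)}`.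
This is the levelled twin of the weighted read-out row `law_mul_units_le_klWtBudget` (…TowerLevelsReadout…, E1 part 15); the (I6) read-out proper (re-measurement at the
read-out family + these units) is E1's / the (ℓ) assembler's.  Pure real arithmetic; nothing about the model is asserted; nothing asserts (ℓ), any stub, K3 or
superconductivity.
References: BGM 2006 Lemma 2.5 (2.98) [cite: BenfattoGiulianiMastropietro2006].
-/

noncomputable section

namespace Summit.HubbardSuperconductivity.HubbardSuperconductivity.Theorems.EngineV8

set_option linter.dupNamespace false -- summit = problem name (single-conjunct summit), D-0017

open Real Literature.MathematicalPhysics.QuantumLattice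
open Summit.HubbardSuperconductivity.HubbardSuperconductivity.Theorems.KLRegimeSplit
open Summit.HubbardSuperconductivity.HubbardSuperconductivity.Theorems.DispersionFlow

/-! ## §1 The unit in the predicate's shape -/

/-- `8^{Jp}/(2^{5J}·2^{eJ}) = 2^{(3p−5)·J}·((2^J)⁻¹)^e` with the ℤ-exponent `(3p − 5)·J` (negative for `p = 1`). [folklore] -/
theorem eight_pow_div_eq_two_zpow (J p e : ℕ) :
    (8 : ℝ) ^ (J * p) / ((2 : ℝ) ^ (5 * J) * (2 : ℝ) ^ (e * J)) = (2 : ℝ) ^ ((3 * (p : ℤ) - 5) * J) * (((2 : ℝ) ^ J)⁻¹) ^ e := by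
  have h2 : (2 : ℝ) ≠ 0 := by norm_num
  have h8 : (8 : ℝ) ^ (J * p) = (2 : ℝ) ^ ((3 * (p : ℤ)) * J) := by
    rw [show (8 : ℝ) = 2 ^ (3 : ℕ) by norm_num, ← pow_mul, ← zpow_natCast]
    congr 1; push_cast; ring
  have h5 : (2 : ℝ) ^ (5 * J) = (2 : ℝ) ^ ((5 : ℤ) * J) := by
    rw [← zpow_natCast]; congr 1
  have he : (((2 : ℝ) ^ J)⁻¹) ^ e = ((2 : ℝ) ^ (e * J))⁻¹ := by
    rw [inv_pow, ← pow_mul, mul_comm]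
  rw [he, h8, h5, div_eq_mul_inv, mul_inv, ← mul_assoc]
  congr 1
  rw [← zpow_neg, ← zpow_add₀ h2]
  congr 1; ring

/-- The floor unit in the shape of `KernelNormsLevels`' right-hand side: `klLevUnitF β M t p J = ε_x^{2p−1}·2^{(3p−5)J}·((2^J)⁻¹)^{levelGainExp (t+1)}`. -/
theorem klLevUnitF_eq_levels_shape (β : ℝ) (M : ℕ) (t : Fin 5) (p J : ℕ) :
    klLevUnitF β M t p J = imagTimeWeight β M ^ (2 * p - 1) * ((2 : ℝ) ^ ((3 * (p : ℤ) - 5) * J) * (((2 : ℝ) ^ J)⁻¹) ^ levelGainExp ((t : ℕ) + 1)) := by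
  unfold klLevUnitF klLevGain
  rw [mul_div_assoc, eight_pow_div_eq_two_zpow]

/-! ## §2 The amplitude against `CE^p` -/

/-- **The law's amplitude fits under `CE^p`**: `A·B^{p−1}·Q^p·ε^{2p−1} ≤ CE^p` for `p ≥ 1`, `B ≥ 1`, `A, Q ≥ 0`, `ε > 0` and `CE ≥ (Q·ε²)·B·max 1 (A/ε)`. -/
theorem law_amplitude_le_pow {A Q B ε CE : ℝ} (hA : 0 ≤ A) (hQ : 0 ≤ Q) (hB : 1 ≤ B) (hε : 0 < ε) (hCE : Q * ε ^ 2 * B * max 1 (A / ε) ≤ CE) {p : ℕ}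
    (hp : 1 ≤ p) : A * B ^ (p - 1) * Q ^ p * ε ^ (2 * p - 1) ≤ CE ^ p := by
  have hB0 : 0 < B := lt_of_lt_of_le one_pos hB
  have hm1 : 1 ≤ max 1 (A / ε) := le_max_left _ _
  have hm0 : 0 ≤ max 1 (A / ε) := le_trans zero_le_one hm1
  have hc0 : 0 ≤ Q * ε ^ 2 * B * max 1 (A / ε) := by positivity
  -- `CE^p ≥ (Qε²B)^p · max(1, A/ε)^p ≥ (Qε²)^p · B^p · (A/ε)`
  have h1 : (Q * ε ^ 2 * B * max 1 (A / ε)) ^ p ≤ CE ^ p := pow_le_pow_left₀ hc0 hCE p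
  have hmp : A / ε ≤ max 1 (A / ε) ^ p :=
    (le_max_right _ _).trans (le_self_pow₀ hm1 (by omega))
  have hBp : B ^ (p - 1) ≤ B ^ p := pow_le_pow_right₀ hB (by omega)
  obtain ⟨q, rfl⟩ : ∃ q, p = q + 1 := ⟨p - 1, by omega⟩
  have hε2 : ε ^ (2 * (q + 1) - 1) = (ε ^ 2) ^ (q + 1) / ε := by
    rw [← pow_mul, show 2 * (q + 1) = (2 * (q + 1) - 1) + 1 by omega, pow_succ, mul_div_assoc, div_self hε.ne', mul_one]
    congr 1
  calc A * B ^ (q + 1 - 1) * Q ^ (q + 1) * ε ^ (2 * (q + 1) - 1)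
      = (Q ^ (q + 1) * (ε ^ 2) ^ (q + 1)) * B ^ (q + 1 - 1) * (A / ε) := by rw [hε2]; ring
    _ ≤ (Q ^ (q + 1) * (ε ^ 2) ^ (q + 1)) * B ^ (q + 1) * max 1 (A / ε) ^ (q + 1) := by
        apply mul_le_mul (mul_le_mul_of_nonneg_left hBp (by positivity)) hmp (div_nonneg hA hε.le) (by positivity)
    _ = (Q * ε ^ 2 * B * max 1 (A / ε)) ^ (q + 1) := by rw [mul_pow, mul_pow, mul_pow]
    _ ≤ CE ^ (q + 1) := h1

/-! ## §3 The read-out units row -/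

/-- **THE LEVELLED LAW'S UNIT TIMES `A·λ^{p−1}·Q^p` IS BELOW `KernelNormsLevels`' RIGHT-HAND SIDE** (floor units, `λ = B·ε_J`): for `p ≥ 1`, `B ≥ 1`, `A, Q ≥ 0`,
`0 < β`, `CE ≥ (Q·ε_x²)·B·max 1 (A/ε_x)`,
`A·(B·ε_J)^{p−1}·Q^p·klLevUnitF β M t p J ≤ CE^p·ε_J^{p−1}·2^{(3p−5)J}·((2^J)⁻¹)^{levelGainExp (t+1)}` (`ε_J = epsCoupling P U J ≥ 0`).
[cite: BenfattoGiulianiMastropietro2006, Lemma 2.5 (2.98)] -/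
theorem law_mul_klLevUnitF_le_levelsRHS {β : ℝ} (hβ : 0 < β) {M : ℕ} [NeZero M] {P : SplitConsts} (hK : 0 ≤ P.Klam) (U : ℝ)
    {A Q B CE : ℝ} (hA : 0 ≤ A) (hQ : 0 ≤ Q) (hB : 1 ≤ B) (hCE : Q * imagTimeWeight β M ^ 2 * B * max 1 (A / imagTimeWeight β M) ≤ CE)
    (t : Fin 5) {p : ℕ} (hp : 1 ≤ p) (J : ℕ) :
    A * (B * epsCoupling P U J) ^ (p - 1) * Q ^ p * klLevUnitF β M t p J ≤
      CE ^ p * epsCoupling P U J ^ (p - 1) * (2 : ℝ) ^ ((3 * (p : ℤ) - 5) * J) * (((2 : ℝ) ^ J)⁻¹) ^ levelGainExp ((t : ℕ) + 1) := by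
  have hx : 0 < imagTimeWeight β M := by
    unfold imagTimeWeight
    have : (0 : ℝ) < M := Nat.cast_pos.2 (Nat.pos_of_ne_zero (NeZero.ne M))
    positivity
  have hε0 : 0 ≤ epsCoupling P U J := by unfold epsCoupling; positivity
  have hamp := law_amplitude_le_pow hA hQ hB hx hCE hp
  have hsh : 0 ≤ (2 : ℝ) ^ ((3 * (p : ℤ) - 5) * J) * (((2 : ℝ) ^ J)⁻¹) ^ levelGainExp ((t : ℕ) + 1) := by positivity
  rw [klLevUnitF_eq_levels_shape, mul_pow]
  calc A * (B ^ (p - 1) * epsCoupling P U J ^ (p - 1)) * Q ^ p *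
        (imagTimeWeight β M ^ (2 * p - 1) * ((2 : ℝ) ^ ((3 * (p : ℤ) - 5) * J) * (((2 : ℝ) ^ J)⁻¹) ^ levelGainExp ((t : ℕ) + 1)))
      = (A * B ^ (p - 1) * Q ^ p * imagTimeWeight β M ^ (2 * p - 1)) * epsCoupling P U J ^ (p - 1) *
          ((2 : ℝ) ^ ((3 * (p : ℤ) - 5) * J) * (((2 : ℝ) ^ J)⁻¹) ^ levelGainExp ((t : ℕ) + 1)) := by ring
    _ ≤ CE ^ p * epsCoupling P U J ^ (p - 1) * ((2 : ℝ) ^ ((3 * (p : ℤ) - 5) * J) * (((2 : ℝ) ^ J)⁻¹) ^ levelGainExp ((t : ℕ) + 1)) :=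
        mul_le_mul_of_nonneg_right (mul_le_mul_of_nonneg_right hamp (pow_nonneg hε0 _)) hsh
    _ = CE ^ p * epsCoupling P U J ^ (p - 1) * (2 : ℝ) ^ ((3 * (p : ℤ) - 5) * J) * (((2 : ℝ) ^ J)⁻¹) ^ levelGainExp ((t : ℕ) + 1) := by ring

end Summit.HubbardSuperconductivity.HubbardSuperconductivity.Theorems.EngineV8

end
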